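import Mathlib.MeasureTheory.Integral.Bochner.Basic
import Mathlib.Analysis.SpecialFunctions.Pow.Real
import Literature.Geometry.Lorentzian.PseudoRiemannianMetric
import Literature.Geometry.Lorentzian.LeviCivita
import Literature.Geometry.Lorentzian.Volume
import Literature.Geometry.Riemannian.IsotropicCurvature
import Literature.Geometry.Riemannian.ConformallyCompactFilling
import Literature.Geometry.Riemannian.YamabeConstant
import HarnessLib

/-!
# Li–Qing–Shi: curvature pinching of conformally compact Einstein manifolds whose conformal
infinity has almost-round Yamabe constant (Trans. AMS 369 (2017), Thm. 1.8; named fact, `n = 5`)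

Topic `Literature/Geometry/Riemannian`. Vendored for route `SmoothPoincare4/EinsteinBulk`: the fact
grounds `Summit.SmoothPoincare4.SmoothPoincare4.Theses.EinsteinBulk.YamabePinchedEinsteinBulk`
(stmt-SmoothPoincare4-7996, "NAMED FACT (LiQingShi2017 Thm 1.8 at n = 5, filed first per the cone
rule, to be vendored in Literature and threaded as a hypothesis)").

Source read (held: arXiv:1410.6402v? = G. Li, J. Qing, Y. Shi, *Gap phenomena and curvature
estimates for conformally compact Einstein manifolds*, Trans. Amer. Math. Soc. 369 (2017)
4385–4413, doi:10.1090/tran/6925), verbatim: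

* PDF p. 4, **Theorem 1.8.** "For any `ε > 0`, there exists `δ > 0`, for any conformally compact
  Einstein manifold `(Xⁿ, g⁺)` (`n ≥ 4`), one gets `|K[g⁺] + 1| ≤ ε`, for all sectional curvature
  `K` of `g⁺`, provided that `Y(∂X, [ĝ]) ≥ (1 − δ) Y(S^{n−1}, [g_S])`. Particularly, any conformally
  compact Einstein manifold with its conformal infinity of Yamabe constant sufficiently close to
  that of the round sphere is necessarily negatively curved."
* PDF p. 6, **Definition 2.1** (conformally compact of `C^{k,α}` regularity, smooth defining
  function, AH normalisation `|dx|²_{x²g⁺}|_{x=0} = 1`, "if, in addition, `g⁺` is at least of `C²`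
  regularity and Einstein, that is, `Ric[g⁺] = −(n−1) g⁺`, then we say `(Xⁿ, g⁺)` is a conformally
  compact Einstein manifold"; conformal infinity `(∂X^{n−1}, [ĝ])`) — vendored as
  `IsConformallyCompactFilling` / `IsPoincareEinsteinFilling` in `ConformallyCompactFilling.lean`.
* PDF p. 3, (1.1): `Y(M, g) = inf { ∫_M ((4(n−1)/(n−2))|∇u|² + R[g]u²) dv[g] /
  (∫_M u^{2n/(n−2)} dv[g])^{(n−2)/n} : u ∈ C_c^∞(M) ∖ {0} }`, "a conformal invariant when `(M, g)`
  is compact with no boundary, in which case we denote it by `Y(M, [g])`".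

## The special case vendored (`liQingShi_pinching_five`) and why it is no more than the source

Bulk dimension `n = 5` (the paper's `Xⁿ`, here the boundaryless interior `N` with `dim N = 5`,
`Ric_g = −4 g`), boundary `M = ∂X̄` a closed `4`-manifold. Two dictionary steps, both classical and
both on the HYPOTHESIS side:

1. `Y(S⁴, [g_S]) = 8√6 π` (`= 4·3·vol(S⁴)^{1/2} = 12 (8π²/3)^{1/2}`; Aubin 1976 / Obata 1971: the
   round metric realises the Yamabe constant of its class; Lee–Parker 1987, §3, Thm. 3.3). The constant is
   written out as the real number `8 * √6 * π`, exactly as the route item does.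
2. On a CLOSED manifold the function-form infimum (1.1) over `u ∈ C^∞ ∖ {0}` equals the infimum of
   `∫ R_h dV_h / Vol(h)^{1/2}` over the smooth metrics `h = u² g₀` (`u > 0`) of the conformal class
   (Lee–Parker 1987, §1–§3: `Q(φ^{p−2}g) = E(φ)/‖φ‖²_p`, and `E(|u|) = E(u)` with density of
   positive smooth functions in `W^{1,2}`), i.e. the tree's `yamabeConstant` (`YamabeConstant.lean`,
   metric form). The hypothesis is therefore rendered, literally as in the route item, as
   "`(1 − δ)·8√6π·√Vol(M,h) ≤ ∫_M R_h dV_h` for every smooth metric `h` conformal to `g₀`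
   (carrying its Levi-Civita connection)" — which says `Y(M,[g₀]) ≥ (1 − δ) Y(S⁴,[g_S])` in the
   metric form (`le_yamabeConstant_of_forall_mul_sqrt_le`).

The manifold binders (`M` compact, connected, Hausdorff, second countable, Borel σ-algebra for the
Riemannian measure; `N` Hausdorff, second countable) only ADD hypotheses relative to the printed
theorem (the paper's `∂X` is automatically compact; connectedness of a conformal infinity of
positive Yamabe type is Witten–Yau / Cai–Galloway, not used). The package
`IsPoincareEinsteinFilling M g₀ N g` = "`Ric_g = −4g` and `(N, g)` is `C²`-conformally compact with
smooth defining function, `|dρ|_ḡ = 1` on `∂X̄`, conformal infinity `[g₀]`" is Def. 2.1 with the AH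
normalisation made explicit (automatic for Einstein `g⁺`, [LiQingShi2017, §2]; again an extra
hypothesis at worst). CONCLUSION: `|K + 1| ≤ ε` for every sectional curvature, rendered on
`g`-orthonormal pairs `(X, Y)` as `|Rm(X,Y,Y,X) + 1| ≤ ε` with the tree's
`curvatureForm` (`IsotropicCurvature.lean`: `Rm(X,Y,Y,X) = g(R(X,Y)Y, X) = K(X∧Y)` on orthonormal
pairs, Lee's sign) of the Levi-Civita connection `(ofRiemannian g).leviCivita`. `δ = δ(ε)` (also
depending on `n = 5`) is ineffective in the source (blow-up argument, pp. 12–13); nothing more is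
claimed. NOT vendored: the general-`n` statement (needs `Y(S^{n−1})` in closed form), Thm. 1.5
(relative volume inequality, `C³` AH), Thm. 1.7 (rigidity), Cor. 1.9.

## References

* [LiQingShi2017] G. Li, J. Qing, Y. Shi, Trans. Amer. Math. Soc. 369 (2017) 4385–4413,
  Thm. 1.8 (arXiv:1410.6402, PDF p. 4), Def. 2.1 (p. 6), (1.1) (p. 3).
* [LeeParker1987] J. M. Lee, T. H. Parker, *The Yamabe problem*, Bull. AMS 17 (1987), §1 (1.5), §3
  (`λ(Sⁿ) = n(n−1) ω_n^{2/n}`).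
* T. Aubin, *Équations différentielles non linéaires et problème de Yamabe concernant la courbure
  scalaire*, J. Math. Pures Appl. 55 (1976) 269–296 (the value `Y(Sⁿ,[g_S]) = n(n−1)ω_n^{2/n}`,
  restated in [LeeParker1987], Thm. 3.3 / §3).
-/

noncomputable section

open MeasureTheory Bundle
open scoped Manifold ContDiff ENNReal

namespace Literature.Geometry.Riemannian

open Literature.Geometry.Lorentzian (PseudoRiemannianMetric riemannianMeasure)
open Literature.Geometry.Lorentzian.PseudoRiemannianMetric

/-- **Li–Qing–Shi 2017, Theorem 1.8, bulk dimension `n = 5`** (named fact, D-0014): "For any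
`ε > 0`, there exists `δ > 0`, for any conformally compact Einstein manifold `(Xⁿ, g⁺)` (`n ≥ 4`),
one gets `|K[g⁺] + 1| ≤ ε` for all sectional curvature `K` of `g⁺`, provided that
`Y(∂X, [ĝ]) ≥ (1 − δ) Y(S^{n−1}, [g_S])`." Here: for every `ε > 0` there is `δ > 0` such that for
every closed smooth `4`-manifold `M` with smooth Riemannian metric `g₀`, every smooth `5`-manifold
`N` with smooth Riemannian metric `g` (with its Levi-Civita connection) such that `(N, g)` is a
Poincaré–Einstein filling of `(M, [g₀])` (`IsPoincareEinsteinFilling`: `Ric_g = −4 g`, `C²`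
conformal compactification with smooth defining function `ρ`, `|dρ|_ḡ = 1` on `∂X̄ = M`,
conformal infinity `[g₀]` — Def. 2.1), IF `(1 − δ)·8√6π·√Vol(M, h) ≤ ∫_M R_h dV_h` for every
smooth metric `h` conformal to `g₀` (i.e. `Y(M, [g₀]) ≥ (1 − δ)·Y(S⁴, [g_S])`, `Y(S⁴) = 8√6π`,
metric form of (1.1) on a closed manifold), THEN `|Rm_g(X, Y, Y, X) + 1| ≤ ε` for every point
`x ∈ N` and every `g`-orthonormal pair `X, Y ∈ T_xN` (all sectional curvatures of `g` are within
`ε` of `−1`). Grounds `Summit.SmoothPoincare4.SmoothPoincare4.Theses.EinsteinBulk.YamabePinchedEinsteinBulk`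
(item = fact with `IsPoincareEinsteinFilling` unfolded to `Ric ∧ package` and `IsConformalTo`
unfolded, both `Iff.rfl`). See the module docstring for the two dictionary steps and what is not
claimed. [cite: LiQingShi2017, Thm. 1.8 (p. 4) and Def. 2.1 (p. 6)] [cite: LeeParker1987, §1 (1.5), §3] -/
def liQingShi_pinching_five : Prop :=
  ∀ ε : ℝ, 0 < ε → ∃ δ : ℝ, 0 < δ ∧
    ∀ (M : Type) [TopologicalSpace M] [T2Space M] [SecondCountableTopology M]
      [ChartedSpace (EuclideanSpace ℝ (Fin 4)) M] [IsManifold (𝓡 4) ∞ M] [CompactSpace M]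
      [ConnectedSpace M] [MeasurableSpace M] [BorelSpace M]
      (g₀ : Bundle.ContMDiffRiemannianMetric (𝓡 4) ∞ (EuclideanSpace ℝ (Fin 4))
        (TangentSpace (𝓡 4) : M → Type _))
      (N : Type) [TopologicalSpace N] [T2Space N] [SecondCountableTopology N]
      [ChartedSpace (EuclideanSpace ℝ (Fin 5)) N] [IsManifold (𝓡 5) ∞ N]
      (g : Bundle.ContMDiffRiemannianMetric (𝓡 5) ∞ (EuclideanSpace ℝ (Fin 5))
        (TangentSpace (𝓡 5) : N → Type _))
      [(PseudoRiemannianMetric.ofRiemannian g).HasLeviCivita],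
      IsPoincareEinsteinFilling M g₀ N g →
      (∀ (h : Bundle.ContMDiffRiemannianMetric (𝓡 4) ∞ (EuclideanSpace ℝ (Fin 4))
          (TangentSpace (𝓡 4) : M → Type _))
          [(PseudoRiemannianMetric.ofRiemannian h).HasLeviCivita],
        IsConformalTo h g₀ →
          (1 - δ) * (8 * Real.sqrt 6 * Real.pi) *
              Real.sqrt ((riemannianMeasure h Set.univ).toReal) ≤
            ∫ x, (PseudoRiemannianMetric.ofRiemannian h).scalarCurvature x
              ∂(riemannianMeasure h)) →
      ∀ (x : N) (X Y : TangentSpace (𝓡 5) x), g.inner x X X = 1 → g.inner x Y Y = 1 →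
        g.inner x X Y = 0 →
        |(PseudoRiemannianMetric.ofRiemannian g).curvatureForm
            (PseudoRiemannianMetric.ofRiemannian g).leviCivita x X Y Y X + 1| ≤ ε

namespace liQingShi_pinching_five

/-- **The route item's literal shape** (`YamabePinchedEinsteinBulk` of route
`SmoothPoincare4/EinsteinBulk`, stmt-SmoothPoincare4-7996): the same statement with the Einstein
equation and the nine-conjunct compactification package as two separate hypotheses and the
conformality relation inlined — obtained from the fact by unfolding `IsPoincareEinsteinFilling`
(a conjunction) and `IsConformalTo` (definitional). [cite: LiQingShi2017, Thm. 1.8 (p. 4)] -/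
theorem inlined (hLQS : liQingShi_pinching_five) :
    ∀ ε : ℝ, 0 < ε → ∃ δ : ℝ, 0 < δ ∧
    ∀ (M : Type) [TopologicalSpace M] [T2Space M] [SecondCountableTopology M]
      [ChartedSpace (EuclideanSpace ℝ (Fin 4)) M] [IsManifold (𝓡 4) ∞ M] [CompactSpace M]
      [ConnectedSpace M] [MeasurableSpace M] [BorelSpace M]
      (g₀ : Bundle.ContMDiffRiemannianMetric (𝓡 4) ∞ (EuclideanSpace ℝ (Fin 4))
        (TangentSpace (𝓡 4) : M → Type _))
      (N : Type) [TopologicalSpace N] [T2Space N] [SecondCountableTopology N]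
      [ChartedSpace (EuclideanSpace ℝ (Fin 5)) N] [IsManifold (𝓡 5) ∞ N]
      (g : Bundle.ContMDiffRiemannianMetric (𝓡 5) ∞ (EuclideanSpace ℝ (Fin 5))
        (TangentSpace (𝓡 5) : N → Type _))
      [(PseudoRiemannianMetric.ofRiemannian g).HasLeviCivita],
      (∀ x, (PseudoRiemannianMetric.ofRiemannian g).ricci x =
          (-4 : ℝ) • (PseudoRiemannianMetric.ofRiemannian g).toBilinForm x) →
      IsConformallyCompactFilling M g₀ N g →
      (∀ (h : Bundle.ContMDiffRiemannianMetric (𝓡 4) ∞ (EuclideanSpace ℝ (Fin 4))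
          (TangentSpace (𝓡 4) : M → Type _))
          [(PseudoRiemannianMetric.ofRiemannian h).HasLeviCivita],
        (∃ φ : M → ℝ, ∀ x : M, 0 < φ x ∧ ∀ v w : TangentSpace (𝓡 4) x,
            h.inner x v w = φ x * g₀.inner x v w) →
          (1 - δ) * (8 * Real.sqrt 6 * Real.pi) *
              Real.sqrt ((riemannianMeasure h Set.univ).toReal) ≤
            ∫ x, (PseudoRiemannianMetric.ofRiemannian h).scalarCurvature x
              ∂(riemannianMeasure h)) →
      ∀ (x : N) (X Y : TangentSpace (𝓡 5) x), g.inner x X X = 1 → g.inner x Y Y = 1 →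
        g.inner x X Y = 0 →
        |(PseudoRiemannianMetric.ofRiemannian g).curvatureForm
            (PseudoRiemannianMetric.ofRiemannian g).leviCivita x X Y Y X + 1| ≤ ε := by
  intro ε hε
  obtain ⟨δ, hδ, H⟩ := hLQS ε hε
  refine ⟨δ, hδ, ?_⟩
  intro M _ _ _ _ _ _ _ _ _ g₀ N _ _ _ _ _ g _ hRic hpack hY
  exact H M g₀ N g ⟨hRic, hpack⟩ (fun h _ hconf => hY h hconf)

end liQingShi_pinching_five

end Literature.Geometry.Riemannian

end
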